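import Literature.MathematicalPhysics.QuantumFieldTheory.Balaban1983to89.B16Ineq19NearFlatSlice

/-!
# `Balaban1983to89.B16Ineq19NearFlatSliceNorms` — [Balaban1989LargeFieldII] (1.7) p. 358 «− O(1)(…)²Σ_{b∈Λ₀}|B′(b)|²» and p. 359 «the subspace of B′ satisfying the gauge condition»: THE NORM GLUE
# between the three currencies of the N12 chain's second-variation letters — the OPERATOR norm (19) of the U2a letters (`Σ_b‖X_b‖²_op`), the pinned HILBERT–SCHMIDT norm (17) of
# `𝔰𝔲(N)`, and the `ℓ²` norm of dag-n12-c's coordinate space `GaugeSlice S T ℝ³ = PiLp 2` in which the `h17` binder measures `Cerr·‖X‖²` — so that the (S5)∕(δ₁)∕(μ) letters enter the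
# assembler's ℓ² reading (dag-n12-c's WORD to n12-w4 g2, INBOX 2026-08-28 l.26741) WITHOUT a volume factor

Honest framing: statement-level skeleton of published theorems with citation tags; proofs where landed; nothing here is a claim about the Yang–Mills mass gap.

Cell `pub-ymgap` (HUMAN RULINGS D-0062 ∕ D-0149), WIDTH SEAT `pub-ymgap-dag-n12-w2` generation 2 (node N12 = [B15]; key K1⁷ `stmt-QuantumFields-20542`, `--kind proof --supports …`; count-neutral);
piece (A1) on the lane owner's word (dag-n12-c g16, INBOX l.≈26930 «(A1) yes, then (B)»).  Imports my `B16Ineq19NearFlatSlice` (p595572) only; nothing of another pen is modified.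

WHAT THIS FILE PROVES (theorems only; no `def`, no `instance`, no `sorry`; axioms standard).
§1 (any `N`) `opNorm_coe_sq_le_norm_sq_lieSU` ∕ `opNorm_coe_le_norm_lieSU` (`‖↑Z‖_op ≤ ‖Z‖_HS` for `Z ∈ 𝔰𝔲(N)`: `MatrixNorms.opNorm_sq_le_sum_norm_sq` + the pinned norm (17)
   `‖Z‖² = Re Tr(Z⋆Z)`), `sum_opNorm_coe_sq_le_sum_norm_sq` (bond fields); the adjoint action is an isometry of both norms BY NAME (`T4AdjointCovarianceUnitary.norm_specialUnitaryAd`,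
   p589772's `Node00.norm_coe_specialUnitaryAd`).
§2 (`SU(2)`, dag-n12-c's slice, any coordinate `φ` with `↑(φ v) = quatMatrix (ι v)`, any background `U`), for the slice chain's RIGHT-chart direction `Y_b := Ad_{U_b⁻¹}(φ(ιA X)_b)` (p592028
   `expMul_su2Chart_eq_expChart`) and its LEFT letter `φ∘ιA X`: ★ `sum_opNorm_sq_lieSU2Coord_ιA` ∕ `sum_opNorm_sq_adDir` (`Σ_b‖·‖²_op = ‖X‖²`), ★ `sum_norm_sq_lieSU2Coord_ιA` ∕ `sum_norm_sq_adDir`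
   (`Σ_b‖·‖²_HS = 2‖X‖²`, w3's `norm_sq_lieSU2Coord`), `opNorm_lieSU2Coord_ιA_le` ∕ `opNorm_adDir_le` (sup-entry `≤ ‖X‖`, `norm_ιA_apply_le`), ★ `sum_opNorm_lieSU2Coord_ιA_le` ∕
   `sum_opNorm_adDir_le` (the ℓ¹ letter of the (μ)-road: `Σ_b‖·‖_op ≤ √#freeBonds · ‖X‖`, Cauchy–Schwarz on the support).
§3 ★★ `inner_fderiv_rGrad_sliceFn_wilsonAction4_nearFlat_ge` — THE (δ₁) LETTER OF THE ASSEMBLER'S SKELETON IN THE :395 PAIRING CURRENCY ON `E := GaugeSlice`: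
   `⟪X, D(∇g₁)(0)X⟫ − 64(d−1)δ·‖X‖² ≤ ⟪X, D(∇g_U)(0)X⟫`, `g_V := sliceFn S T wilsonAction4 V`, for `‖U_b − 1‖ ≤ δ` on all bonds (file 2's `abs_deriv_deriv_wilsonAction4_expMul_su2Chart_ιA_sub_one_le`
   read through `inner_fderiv_rGrad_sliceFn_wilsonAction4_eq` twice); `…_local` (the background near `1` only on the plaquettes meeting a free bond); `abs_inner_fderiv_rGrad_sliceFn_wilsonAction4_le`
   (the (β)-diagonal `|⟪X, D(∇g_U)(0)X⟫| ≤ 8(d−1)‖X‖²` at EVERY background).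

HONEST SCOPE.  Norm bookkeeping only; k-level bare-action currency as in files 1–3 of (S5); count-neutral; N12 NOT discharged (5∕27 unmoved); finite 𝕋⁴ at fixed ε; R4 closes only the conditional
rung `BalabanLadder.UV` — the Yang–Mills mass gap (Clay) is NOT proved by any of this; nothing continuum ∕ ℝ⁴ ∕ OS.  CONSUMED BY NAME: `MatrixNorms.opNorm_sq_le_sum_norm_sq` ∕ `sum_norm_sq_eq_re_trace`,
p587195 `Node00.norm_sq_lieSU_eq_re_trace`, p589772 `Node00.norm_coe_specialUnitaryAd`, w3's `B16Ineq19FlatSliceChart.norm_sq_lieSU2Coord`, dag-n12-c's `B15Prop1SliceCoordinates.norm_ιA_apply_le`,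
this seat's `B16Ineq19NearFlatSlice.{norm_coe_lieSU2Coord, sum_norm_sq_ιA, inner_fderiv_rGrad_sliceFn_wilsonAction4_eq, abs_deriv_deriv_wilsonAction4_expMul_su2Chart_ιA_sub_one_le(_local)}`,
`Node00.abs_deriv_deriv_wilsonAction4_expChart_le_l2`.  0 kit, 0 lit wants.

## References
* [Balaban1989LargeFieldII] T. Bałaban, Commun. Math. Phys. 122 (1989) 355–392: (1.7)–(1.9) p. 358, p. 359, (1.12) p. 359.
* [Balaban1985Averaging] T. Bałaban, Commun. Math. Phys. 98 (1985) 17–51: (17) p. 20–21 (`⟨X,X⟩ = tr X*X`), (19)–(20) p. 21 (`|U − 1|`, `|tr M| ≤ ‖M‖`), (57) p. 27.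
-/

noncomputable section

open Finset Filter Topology

namespace Literature.MathematicalPhysics.QuantumFieldTheory.Balaban1983to89.B16Ineq19NearFlatSliceNorms

open GaugeField
open T4AdjointCovarianceUnitary (lieSU expSU coe_expSU specialUnitaryAd coe_specialUnitaryAd norm_specialUnitaryAd)
open T4CubeChartGnomonic (SU2)
open T4HaarSU2ExpChart (imQuat)
open Literature.MathematicalPhysics.QuantumLattice (quatMatrix)
open B16Sect1Backgrounds (expMul)
open B15Prop1ChartSU2 (su2Chart)
open B15Prop1SliceCoordinates (GaugeSlice ιA freeBonds ιA_apply_of_mem ιA_apply_of_not_mem norm_ιA_apply_le)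
open B15Prop1SliceTaylorCalculus (sliceFn rGrad)
open B16Ineq19FlatSliceChart (norm_sq_lieSU2Coord)
open B16Ineq19NearFlatSlice (norm_coe_lieSU2Coord sum_norm_sq_ιA inner_fderiv_rGrad_sliceFn_wilsonAction4_eq abs_deriv_deriv_wilsonAction4_expMul_su2Chart_ιA_sub_one_le
  abs_deriv_deriv_wilsonAction4_expMul_su2Chart_ιA_sub_one_le_local expMul_su2Chart_smul_eq_leftChart)
open Node00 (SU expChart norm_sq_lieSU_eq_re_trace norm_coe_specialUnitaryAd abs_deriv_deriv_wilsonAction4_expChart_le_l2 expMul_su2Chart_eq_expChart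
  deriv_deriv_wilsonAction4_leftChart_eq)
open scoped Matrix.Norms.L2Operator

variable {P : Params} {k : ℕ}

/-! ## §1  Operator norm (19) ≤ Hilbert–Schmidt norm (17) on `𝔰𝔲(N)` -/

section AnyN

variable {N : ℕ}

/-- **`‖↑Z‖²_op ≤ ‖Z‖²_HS`** for `Z ∈ 𝔰𝔲(N)`: the operator norm (19) is dominated by the pinned Hilbert–Schmidt norm (17) `‖Z‖² = Re Tr(Z⋆Z) = Σ_ij|Z_ij|²` (`MatrixNorms.opNorm_sq_le_sum_norm_sq`).
[cite: Balaban1985Averaging, (17) p.20, (19) p.21] -/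
theorem opNorm_coe_sq_le_norm_sq_lieSU (Z : lieSU (Fin N)) : ‖(Z : Matrix (Fin N) (Fin N) ℂ)‖ ^ 2 ≤ ‖Z‖ ^ 2 := by
  rw [norm_sq_lieSU_eq_re_trace, Matrix.star_eq_conjTranspose, ← MatrixNorms.sum_norm_sq_eq_re_trace]
  exact MatrixNorms.opNorm_sq_le_sum_norm_sq _

/-- `‖↑Z‖_op ≤ ‖Z‖_HS` for `Z ∈ 𝔰𝔲(N)`. [cite: Balaban1985Averaging, (17) p.20, (19) p.21] -/
theorem opNorm_coe_le_norm_lieSU (Z : lieSU (Fin N)) : ‖(Z : Matrix (Fin N) (Fin N) ℂ)‖ ≤ ‖Z‖ := by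
  have h := opNorm_coe_sq_le_norm_sq_lieSU Z
  nlinarith [norm_nonneg (Z : Matrix (Fin N) (Fin N) ℂ), norm_nonneg Z]

/-- **Bond fields**: `Σ_b‖↑Y_b‖²_op ≤ Σ_b‖Y_b‖²_HS` — the `ℓ²(bonds)` letters of (S5) in the operator norm are dominated by the Hilbert–Schmidt `ℓ²` norm.
[cite: Balaban1989LargeFieldII, (1.7) p.358; Balaban1985Averaging, (17) p.20, (19) p.21] -/
theorem sum_opNorm_coe_sq_le_sum_norm_sq {j : ℕ} (Y : PBond P j → lieSU (Fin N)) :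
    ∑ b : PBond P j, ‖(Y b : Matrix (Fin N) (Fin N) ℂ)‖ ^ 2 ≤ ∑ b : PBond P j, ‖Y b‖ ^ 2 :=
  Finset.sum_le_sum fun b _ => opNorm_coe_sq_le_norm_sq_lieSU (Y b)

end AnyN

/-! ## §2  At `SU(2)` on dag-n12-c's slice: the letters of the slice chain's directions in the three norms -/

section Slice

variable {φ : EuclideanSpace ℝ (Fin 3) →ₗ[ℝ] lieSU (Fin 2)} [DecidableEq (PBond P k)] {S : Set (Site P k)} {T : Finset (PBond P k)}

/-- ★ **LEFT letter, operator norm**: `Σ_b‖↑(φ(ιA X)_b)‖²_op = ‖X‖²` (the coordinate is an op-isometry, `ιA` an `ℓ²` isometry). [cite: Balaban1989LargeFieldII, (1.7) p.358, p.359] -/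
theorem sum_opNorm_sq_lieSU2Coord_ιA (hφ : ∀ v, ((φ v : lieSU (Fin 2)) : Matrix (Fin 2) (Fin 2) ℂ) = quatMatrix (imQuat v))
    (X : GaugeSlice S T (EuclideanSpace ℝ (Fin 3))) :
    ∑ b : PBond P k, ‖((φ (ιA S T X b) : lieSU (Fin 2)) : Matrix (Fin 2) (Fin 2) ℂ)‖ ^ 2 = ‖X‖ ^ 2 := by
  simp only [norm_coe_lieSU2Coord hφ, sum_norm_sq_ιA]

/-- ★ **LEFT letter, Hilbert–Schmidt norm**: `Σ_b‖φ(ιA X)_b‖²_HS = 2‖X‖²` (w3's `norm_sq_lieSU2Coord`: `‖φ v‖² = 2‖v‖²`). [cite: Balaban1989LargeFieldII, (1.7) p.358; Balaban1985Averaging, (17) p.20] -/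
theorem sum_norm_sq_lieSU2Coord_ιA (hφ : ∀ v, ((φ v : lieSU (Fin 2)) : Matrix (Fin 2) (Fin 2) ℂ) = quatMatrix (imQuat v))
    (X : GaugeSlice S T (EuclideanSpace ℝ (Fin 3))) :
    ∑ b : PBond P k, ‖φ (ιA S T X b)‖ ^ 2 = 2 * ‖X‖ ^ 2 := by
  simp only [norm_sq_lieSU2Coord hφ, ← Finset.mul_sum, sum_norm_sq_ιA]

/-- ★ **RIGHT-chart direction, operator norm**: for `Y_b = Ad_{U_b⁻¹}(φ(ιA X)_b)` (p592028's letter change at the background `U`), `Σ_b‖↑Y_b‖²_op = ‖X‖²`.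
[cite: Balaban1989LargeFieldII, (1.7) p.358, (1.19) p.360; Balaban1985Averaging, (57) p.27] -/
theorem sum_opNorm_sq_adDir (hφ : ∀ v, ((φ v : lieSU (Fin 2)) : Matrix (Fin 2) (Fin 2) ℂ) = quatMatrix (imQuat v))
    (X : GaugeSlice S T (EuclideanSpace ℝ (Fin 3))) (U : GaugeField P k SU2) :
    ∑ b : PBond P k, ‖((specialUnitaryAd (U b)⁻¹ (φ (ιA S T X b)) : lieSU (Fin 2)) : Matrix (Fin 2) (Fin 2) ℂ)‖ ^ 2 = ‖X‖ ^ 2 := by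
  simp only [norm_coe_specialUnitaryAd, norm_coe_lieSU2Coord hφ, sum_norm_sq_ιA]

/-- **RIGHT-chart direction, Hilbert–Schmidt norm**: `Σ_b‖Y_b‖²_HS = 2‖X‖²`. [cite: Balaban1989LargeFieldII, (1.7) p.358; Balaban1985Averaging, (17) p.20, (57) p.27] -/
theorem sum_norm_sq_adDir (hφ : ∀ v, ((φ v : lieSU (Fin 2)) : Matrix (Fin 2) (Fin 2) ℂ) = quatMatrix (imQuat v))
    (X : GaugeSlice S T (EuclideanSpace ℝ (Fin 3))) (U : GaugeField P k SU2) :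
    ∑ b : PBond P k, ‖specialUnitaryAd (U b)⁻¹ (φ (ιA S T X b))‖ ^ 2 = 2 * ‖X‖ ^ 2 := by
  simp only [norm_specialUnitaryAd, norm_sq_lieSU2Coord hφ, ← Finset.mul_sum, sum_norm_sq_ιA]

/-- **Sup-entry letter**: `‖↑(φ(ιA X)_b)‖_op ≤ ‖X‖` for every bond (dag-n12-c's `norm_ιA_apply_le`). [cite: Balaban1989LargeFieldII, (1.8)–(1.9) p.358] -/
theorem opNorm_lieSU2Coord_ιA_le (hφ : ∀ v, ((φ v : lieSU (Fin 2)) : Matrix (Fin 2) (Fin 2) ℂ) = quatMatrix (imQuat v))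
    (X : GaugeSlice S T (EuclideanSpace ℝ (Fin 3))) (b : PBond P k) :
    ‖((φ (ιA S T X b) : lieSU (Fin 2)) : Matrix (Fin 2) (Fin 2) ℂ)‖ ≤ ‖X‖ := by
  rw [norm_coe_lieSU2Coord hφ]
  exact norm_ιA_apply_le X b

/-- The same for the right-chart direction: `‖↑(Ad_{U_b⁻¹}(φ(ιA X)_b))‖_op ≤ ‖X‖`. [cite: Balaban1989LargeFieldII, (1.8)–(1.9) p.358; Balaban1985Averaging, (57) p.27] -/
theorem opNorm_adDir_le (hφ : ∀ v, ((φ v : lieSU (Fin 2)) : Matrix (Fin 2) (Fin 2) ℂ) = quatMatrix (imQuat v))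
    (X : GaugeSlice S T (EuclideanSpace ℝ (Fin 3))) (U : GaugeField P k SU2) (b : PBond P k) :
    ‖((specialUnitaryAd (U b)⁻¹ (φ (ιA S T X b)) : lieSU (Fin 2)) : Matrix (Fin 2) (Fin 2) ℂ)‖ ≤ ‖X‖ := by
  rw [norm_coe_specialUnitaryAd]
  exact opNorm_lieSU2Coord_ιA_le hφ X b

/-- Cauchy–Schwarz on the free bonds: `Σ_b ‖(ιA X)_b‖ ≤ √#freeBonds · ‖X‖` (the field vanishes off the free bonds). [cite: Balaban1989LargeFieldII, p.359 (bookkeeping)] -/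
theorem sum_norm_ιA_le (X : GaugeSlice S T (EuclideanSpace ℝ (Fin 3))) :
    ∑ b : PBond P k, ‖ιA S T X b‖ ≤ Real.sqrt ((freeBonds S T).card) * ‖X‖ := by
  classical
  have hsupp : ∑ b : PBond P k, ‖ιA S T X b‖ = ∑ b ∈ freeBonds S T, ‖ιA S T X b‖ := by
    refine (Finset.sum_subset (Finset.subset_univ _) fun b _ hb => ?_).symm
    rw [ιA_apply_of_not_mem X hb, norm_zero]
  have hsq : ∑ b ∈ freeBonds S T, ‖ιA S T X b‖ ^ 2 ≤ ‖X‖ ^ 2 := by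
    rw [← sum_norm_sq_ιA X]
    exact Finset.sum_le_sum_of_subset_of_nonneg (Finset.subset_univ _) fun b _ _ => sq_nonneg _
  have hcs := Finset.sum_mul_sq_le_sq_mul_sq (freeBonds S T) (fun _ => (1 : ℝ)) (fun b => ‖ιA S T X b‖)
  simp only [one_mul, one_pow, Finset.sum_const, nsmul_eq_mul, mul_one] at hcs
  have hnn : 0 ≤ ∑ b ∈ freeBonds S T, ‖ιA S T X b‖ := Finset.sum_nonneg fun b _ => norm_nonneg _
  have hcard : (0 : ℝ) ≤ (freeBonds S T).card := Nat.cast_nonneg _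
  have hM : 0 ≤ Real.sqrt ((freeBonds S T).card) * ‖X‖ := by positivity
  have hle : (∑ b ∈ freeBonds S T, ‖ιA S T X b‖) ^ 2 ≤ (Real.sqrt ((freeBonds S T).card) * ‖X‖) ^ 2 := by
    rw [mul_pow, Real.sq_sqrt hcard]
    exact hcs.trans (mul_le_mul_of_nonneg_left hsq hcard)
  rw [hsupp]
  have h := Real.sqrt_le_sqrt hle
  rwa [Real.sqrt_sq hnn, Real.sqrt_sq hM] at h

/-- ★ **THE ℓ¹ LETTER OF THE (μ)-ROAD, LEFT letter**: `Σ_b ‖↑(φ(ιA X)_b)‖_op ≤ √#freeBonds · ‖X‖` (n12-w4 g2's `abs_deriv_wilsonAction4_expChart_zero_le_l1` pairs against this sum).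
[cite: Balaban1989LargeFieldII, (1.12) p.359 («⟨δB′, H_{1,k}J_{k,Z}⟩»), p.359] -/
theorem sum_opNorm_lieSU2Coord_ιA_le (hφ : ∀ v, ((φ v : lieSU (Fin 2)) : Matrix (Fin 2) (Fin 2) ℂ) = quatMatrix (imQuat v))
    (X : GaugeSlice S T (EuclideanSpace ℝ (Fin 3))) :
    ∑ b : PBond P k, ‖((φ (ιA S T X b) : lieSU (Fin 2)) : Matrix (Fin 2) (Fin 2) ℂ)‖ ≤ Real.sqrt ((freeBonds S T).card) * ‖X‖ := by
  simp only [norm_coe_lieSU2Coord hφ]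
  exact sum_norm_ιA_le X

/-- The same for the right-chart direction: `Σ_b ‖↑(Ad_{U_b⁻¹}(φ(ιA X)_b))‖_op ≤ √#freeBonds · ‖X‖`. [cite: Balaban1989LargeFieldII, (1.12) p.359; Balaban1985Averaging, (57) p.27] -/
theorem sum_opNorm_adDir_le (hφ : ∀ v, ((φ v : lieSU (Fin 2)) : Matrix (Fin 2) (Fin 2) ℂ) = quatMatrix (imQuat v))
    (X : GaugeSlice S T (EuclideanSpace ℝ (Fin 3))) (U : GaugeField P k SU2) :
    ∑ b : PBond P k, ‖((specialUnitaryAd (U b)⁻¹ (φ (ιA S T X b)) : lieSU (Fin 2)) : Matrix (Fin 2) (Fin 2) ℂ)‖ ≤ Real.sqrt ((freeBonds S T).card) * ‖X‖ := by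
  simp only [norm_coe_specialUnitaryAd, norm_coe_lieSU2Coord hφ]
  exact sum_norm_ιA_le X

end Slice

/-! ## §3  The (δ₁) letter of the assembler's skeleton in the :395 pairing currency on `E := GaugeSlice` -/

section DeltaOne

variable [DecidableEq (PBond P k)] {S : Set (Site P k)} {T : Finset (PBond P k)}

/-- ★★ **(δ₁) IN THE PAIRING CURRENCY**: for every background `U` with `‖U_b − 1‖ ≤ δ` on all bonds and every coordinate vector `X`,
`⟪X, D(∇g₁)(0)X⟫ − 64(d−1)δ·‖X‖² ≤ ⟪X, D(∇g_U)(0)X⟫` where `g_V := sliceFn S T wilsonAction4 V` — the Hessian pairing of the slice function at the near-flat background dominates the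
flat one minus the ℓ² letter (file 2's comparison read through `inner_fderiv_rGrad_sliceFn_wilsonAction4_eq` at `V = U` and at `V = 1`).
[cite: Balaban1989LargeFieldII, p.357, (1.7) p.358, (1.12) p.359] -/
theorem inner_fderiv_rGrad_sliceFn_wilsonAction4_nearFlat_ge (U : GaugeField P k SU2) {δ : ℝ}
    (hδ : ∀ b : PBond P k, ‖((U b : SU2) : Matrix (Fin 2) (Fin 2) ℂ) - 1‖ ≤ δ) (X : GaugeSlice S T (EuclideanSpace ℝ (Fin 3))) :
    inner ℝ X (fderiv ℝ (rGrad S T (sliceFn S T wilsonAction4 (1 : GaugeField P k SU2))) 0 X) - 64 * ((P.d : ℝ) - 1) * δ * ‖X‖ ^ 2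
      ≤ inner ℝ X (fderiv ℝ (rGrad S T (sliceFn S T wilsonAction4 U)) 0 X) := by
  rw [inner_fderiv_rGrad_sliceFn_wilsonAction4_eq, inner_fderiv_rGrad_sliceFn_wilsonAction4_eq]
  have h := (abs_sub_le_iff.1 (abs_deriv_deriv_wilsonAction4_expMul_su2Chart_ιA_sub_one_le X U hδ)).2
  linarith

/-- The same, SUPPORT-LOCAL: the background `δ`-close to `1` only on the four bonds of the plaquettes meeting a free bond. [cite: Balaban1989LargeFieldII, p.357, (1.7) p.358] -/
theorem inner_fderiv_rGrad_sliceFn_wilsonAction4_nearFlat_ge_local (U : GaugeField P k SU2) {δ : ℝ} (hδ0 : 0 ≤ δ)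
    (hδ : ∀ p : Plaq P k, ((⟨p.src, p.μ⟩ : PBond P k) ∈ freeBonds S T ∨ (⟨p.src.shift p.μ, p.ν⟩ : PBond P k) ∈ freeBonds S T
        ∨ (⟨p.src.shift p.ν, p.μ⟩ : PBond P k) ∈ freeBonds S T ∨ (⟨p.src, p.ν⟩ : PBond P k) ∈ freeBonds S T) →
      ‖((U ⟨p.src, p.μ⟩ : SU2) : Matrix (Fin 2) (Fin 2) ℂ) - 1‖ ≤ δ ∧ ‖((U ⟨p.src.shift p.μ, p.ν⟩ : SU2) : Matrix (Fin 2) (Fin 2) ℂ) - 1‖ ≤ δ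
        ∧ ‖((U ⟨p.src.shift p.ν, p.μ⟩ : SU2) : Matrix (Fin 2) (Fin 2) ℂ) - 1‖ ≤ δ ∧ ‖((U ⟨p.src, p.ν⟩ : SU2) : Matrix (Fin 2) (Fin 2) ℂ) - 1‖ ≤ δ)
    (X : GaugeSlice S T (EuclideanSpace ℝ (Fin 3))) :
    inner ℝ X (fderiv ℝ (rGrad S T (sliceFn S T wilsonAction4 (1 : GaugeField P k SU2))) 0 X) - 64 * ((P.d : ℝ) - 1) * δ * ‖X‖ ^ 2
      ≤ inner ℝ X (fderiv ℝ (rGrad S T (sliceFn S T wilsonAction4 U)) 0 X) := by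
  rw [inner_fderiv_rGrad_sliceFn_wilsonAction4_eq, inner_fderiv_rGrad_sliceFn_wilsonAction4_eq]
  have h := (abs_sub_le_iff.1 (abs_deriv_deriv_wilsonAction4_expMul_su2Chart_ιA_sub_one_le_local X U hδ0 hδ)).2
  linarith

/-- **THE (β)-DIAGONAL AT EVERY BACKGROUND**: `|⟪X, D(∇g_U)(0)X⟫| ≤ 8(d−1)·‖X‖²`, `g_U = sliceFn S T wilsonAction4 U` — the Hessian pairing of the slice function is bounded uniformly in the
background (file 1's `abs_deriv_deriv_wilsonAction4_expChart_le_l2` at the right-chart direction, whose `ℓ²(bonds)`-op letter is `‖X‖²`). [cite: Balaban1985BackgroundPropagators, (3.10) p.392; Balaban1989LargeFieldII, (1.12) p.359] -/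
theorem abs_inner_fderiv_rGrad_sliceFn_wilsonAction4_le (U : GaugeField P k SU2) (X : GaugeSlice S T (EuclideanSpace ℝ (Fin 3))) :
    |inner ℝ X (fderiv ℝ (rGrad S T (sliceFn S T wilsonAction4 U)) 0 X)| ≤ 8 * ((P.d : ℝ) - 1) * ‖X‖ ^ 2 := by
  obtain ⟨φ, hφ⟩ := B16Ineq19FlatSliceChart.exists_lieSU2Coord
  rw [inner_fderiv_rGrad_sliceFn_wilsonAction4_eq]
  have hfun : (fun s : ℝ => wilsonAction4 (expMul su2Chart (s • ιA S T X) U))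
      = fun t : ℝ => wilsonAction4 (fun b => expSU ((t • fun b => φ (ιA S T X b)) b) * U b) := by
    funext s
    rw [expMul_su2Chart_smul_eq_leftChart hφ]
  rw [hfun, deriv_deriv_wilsonAction4_leftChart_eq]
  have h := abs_deriv_deriv_wilsonAction4_expChart_le_l2 (N := 2) U (fun b => specialUnitaryAd (U b)⁻¹ (φ (ιA S T X b)))
  rw [sum_opNorm_sq_adDir hφ X U] at h
  exact h

end DeltaOne

end Literature.MathematicalPhysics.QuantumFieldTheory.Balaban1983to89.B16Ineq19NearFlatSliceNorms

end
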